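import Summits.CriticalPhenomena.Ising3DConformalLimit.Theses.ConformalPoissonDevice
import Summits.CriticalPhenomena.Ising3DConformalLimit.Theorems.MonotoneBlockingLimitsAreConformalSummit
import Summits.CriticalPhenomena.Ising3DConformalLimit.Theorems.ConformalPoissonDeviceDeviceWeylUniversalityStubDeviceZero
import Summits.CriticalPhenomena.Ising3DConformalLimit.Theorems.ConformalPoissonDeviceDeviceWeylUniversalityStubDeviceOdd
import Summits.CriticalPhenomena.Ising3DConformalLimit.Theorems.ConformalPoissonDeviceDeviceWeylUniversalityReduction
import Literature.Analysis.FunctionSpaces.PoissonPointProcessExistence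
import Literature.Probability.LatticeModels.CriticalScalingDimension
import Literature.Probability.LatticeModels.AnnealedDeviceCorr
import Literature.Probability.LatticeModels.PoissonDelaunayIsing
import HarnessLib

/-!
# Crux `ConformalPoissonDevice.DeviceWeylUniversality` (stmt-CriticalPhenomena-4722) — the COSTUME THEOREMS
# of the redirect strategist's census (unit `cstrat-stmt-CriticalPhenomena-4722-r1`, 2026-08-17)

Route `ConformalPoissonDevice`, sub-problem `Ising3DConformalLimit` (`S`).  The tree knows
(`LimitsAreConformalSummit.summit_iff_three_hubs`, landed) that

  `S ↔ L ∧ D ∧ N`,   `L` = `ExistsScaleCovariantLimit` (stmt-1981), `D` = `InversionUpgradeNormalised`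
  (stmt-1982), `N` = `IsingEuclidUpgradeR4NonGaussian` (stmt-0636).

The route's deciding theorem `closes` consumes `W` = `DeviceWeylUniversality` (this crux), `L`, `N` and the three
"provable-now" support items `E` = `DeviceInversionSymmetry` (4724), `IT` = `InversionTransfer` (4725),
`MFI` = `MoebiusFromInversion` (4726).  This file proves, sorry-free:

* §1 `delta_eq_of_isScaleCovariant` — two scale weights of a non-degenerate family coincide (folklore glue).
* §2 `deviceWeylUniversality_of_no_limit` — `W` is VACUOUSLY TRUE when no non-degenerate pointwise scaling limit of
  `criticalCorr 3` exists: `W` carries no existence content (it cannot touch hub `L`).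
* §3 `inversionUpgradeNormalised_of_deviceWeylUniversality` — **`W → E → IT → MFI → D`**: modulo the route's own
  provable glue the crux IMPLIES the summit's open hub conjunct `D` (stmt-1982); with `summit_iff_three_hubs` the
  route's load-bearing cone `{W, L, N}` is `{≥ D, L, N}`, i.e. the three hubs of `S` with `D` dressed as `W`
  (`summit_of_route_cone`, `assembly_via_hubs : ConformalPoissonDevice.Assembly`).
* §4 `flatPDLimit_moebius_of_weylLawEven` — one level down (the landed split `U'' → W'' → W`, p156513): the piece
  `W''` (`stub_deviceWeylLawEven`) together with the same glue forces EVERY admissible flat Poisson–Delaunay limit `T`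
  to be Möbius covariant — `W''` contains hub `D` transplanted to the Poisson–Delaunay model (`D_PD`), the same
  scale ⇒ conformal upgrade, for a model with strictly fewer rigorous tools.

Nothing here closes an item; the file is census evidence (`STRATEGY-CENSUS.md` of the crux).  No new Literature facts,
no `sorry`; axioms standard.
-/

noncomputable section

namespace Summit.CriticalPhenomena.Ising3DConformalLimit.Cruxes.DeviceWeylUniversality.Costume

open MeasureTheory Filter Set Topology
open Literature.Analysis.FunctionSpaces Literature.Probability.LatticeModels
open Summit.CriticalPhenomena.Ising3DConformalLimit.Theses
open Summit.CriticalPhenomena.Ising3DConformalLimit.Theorems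

/-! ## §0 The device laws exist (Kingman), so the `∀ P, hP → …` quantifier of the crux is not vacuous -/

/-- Existence of the device's Poisson laws `P_N` of intensity `N(1+‖z‖²)⁻³dz` (finite total mass `N·π²/4`,
atomless), by the tree's Kingman existence theorem `existsUnique_isPoissonPointProcess_holds`. [folklore] -/
theorem exists_deviceLaws :
    ∃ P : ℕ → Measure (PointConfig (EuclideanSpace ℝ (Fin 3))),
      ∀ N : ℕ, IsPoissonPointProcess ((N : ENNReal) •
        (volume : Measure (EuclideanSpace ℝ (Fin 3))).withDensity
          (fun z => ENNReal.ofReal ((1 + ‖z‖ ^ 2) ^ (-(3:ℝ))))) (P N) := by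
  have hex : ∀ N : ℕ, ∃ P : Measure (PointConfig (EuclideanSpace ℝ (Fin 3))),
      IsPoissonPointProcess ((N : ENNReal) •
        (volume : Measure (EuclideanSpace ℝ (Fin 3))).withDensity
          (fun z => ENNReal.ofReal ((1 + ‖z‖ ^ 2) ^ (-(3:ℝ))))) P := by
    intro N
    haveI : IsFiniteMeasure ((N : ENNReal) •
        (volume : Measure (EuclideanSpace ℝ (Fin 3))).withDensity
          (fun z => ENNReal.ofReal ((1 + ‖z‖ ^ 2) ^ (-(3:ℝ))))) :=
      ⟨(DeviceWeylUniversality.deviceZero_intensity_univ_ne_top N).lt_top⟩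
    have hν0 : ∀ x : EuclideanSpace ℝ (Fin 3), ((N : ENNReal) •
        (volume : Measure (EuclideanSpace ℝ (Fin 3))).withDensity
          (fun z => ENNReal.ofReal ((1 + ‖z‖ ^ 2) ^ (-(3:ℝ))))) {x} = 0 := fun x => by
      rw [Measure.smul_apply, withDensity_absolutelyContinuous _ _ (measure_singleton x), smul_zero]
    have h := existsUnique_isPoissonPointProcess_holds (E := EuclideanSpace ℝ (Fin 3))
    exact (h _ hν0).exists
  choose P hP using hex
  exact ⟨P, hP⟩

/-! ## §1 Glue: the scale weight of a non-degenerate family is unique -/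

/-- Two scale weights of a family with non-degenerate two-point function coincide (read `S₂` at `(0,e)` and
`(0,2e)`). [folklore] -/
theorem delta_eq_of_isScaleCovariant {S : CorrFamily 3} {Δ Δ' : ℝ} (hnd : IsNondegenerateTwoPoint S)
    (h : IsScaleCovariant Δ S) (h' : IsScaleCovariant Δ' S) : Δ = Δ' := by
  have hpos : 0 < S 2 ![0, EuclideanSpace.single (0 : Fin 3) ((1 : ℕ) : ℝ)] :=
    hnd _ (zero_unitVec_mem_nonCoincident (by norm_num))
  have e : (2 : ℝ) ^ (-(2 : ℝ) * Δ) = (2 : ℝ) ^ (-(2 : ℝ) * Δ') := by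
    have h1 := S_two_unitVec_eq (S := S) h
    have h2 := S_two_unitVec_eq (S := S) h'
    exact mul_right_cancel₀ hpos.ne' (h1.symm.trans h2)
  have hlog := congrArg Real.log e
  rw [Real.log_rpow two_pos, Real.log_rpow two_pos] at hlog
  have hl : (0 : ℝ) < Real.log 2 := Real.log_pos one_lt_two
  have h3 := mul_right_cancel₀ hl.ne' hlog
  linarith

/-! ## §2 `W` is vacuous where hub `L` fails: it has no existence content -/

/-- If NO non-degenerate pointwise scaling limit of the critical `ℤ³` correlators exists (any `ρ > 0` on `(0,1]`),
the crux `DeviceWeylUniversality` holds vacuously. Hence `W` can never contribute to the existence hub `L`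
(stmt-1981) of the sub-problem. [folklore] -/
theorem deviceWeylUniversality_of_no_limit
    (h : ∀ (ρ : ℝ → ℝ) (S : CorrFamily 3), (∀ δ ∈ Set.Ioc (0:ℝ) 1, 0 < ρ δ) →
      HasPointwiseScalingLimit (criticalCorr 3) ρ S → ¬ IsNondegenerateTwoPoint S) :
    ConformalPoissonDevice.DeviceWeylUniversality := by
  intro P F hP hF ρ S hρ hlim hnd
  exact absurd hnd (h ρ S hρ hlim)

/-- The same with the existential spelled out: `¬ (∃ ρ S, ρ > 0 ∧ limit ∧ non-degenerate) → W`. [folklore] -/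
theorem deviceWeylUniversality_of_not_exists_limit
    (h : ¬ ∃ (ρ : ℝ → ℝ) (S : CorrFamily 3), (∀ δ ∈ Set.Ioc (0:ℝ) 1, 0 < ρ δ) ∧
      HasPointwiseScalingLimit (criticalCorr 3) ρ S ∧ IsNondegenerateTwoPoint S) :
    ConformalPoissonDevice.DeviceWeylUniversality :=
  deviceWeylUniversality_of_no_limit fun ρ S hρ hlim hnd => h ⟨ρ, S, hρ, hlim, hnd⟩

/-! ## §3 THE COSTUME: `W` + the route's provable glue ⇒ hub `D` (stmt-1982) -/

/-- **`W → E → IT → MFI → D`.** Modulo the route's own "provable-now" support items (device inversion symmetry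
`E`, the limit-transfer identity `IT`, and the group fact `⟨translations, ι⟩ = Möb(3)` `MFI`), the crux
`DeviceWeylUniversality` implies the summit's open hub conjunct `InversionUpgradeNormalised` (stmt-1982): feed the
Kingman device laws and `F := annealedDeviceCorr` (for which `hF` is `rfl`) to `W`; transfer the exact `ι`-symmetry
of the device to the limit (`IT`); `MFI` makes the limit Möbius with `W`'s weight `Δ'`, whose scale part pins
`Δ' = Δ` by non-degeneracy. (The Euclidean hypothesis of `D` is used only through translations.) [folklore] -/
theorem inversionUpgradeNormalised_of_deviceWeylUniversality
    (hW : ConformalPoissonDevice.DeviceWeylUniversality)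
    (hE : ConformalPoissonDevice.DeviceInversionSymmetry)
    (hIT : ConformalPoissonDevice.InversionTransfer)
    (hMFI : ConformalPoissonDevice.MoebiusFromInversion) :
    HyperoctahedralRP.InversionUpgradeNormalised := by
  intro ρ Δ S hρ hlim hnorm hnd heuc hsc
  obtain ⟨P, hP⟩ := exists_deviceLaws
  -- W: a coupling `β`, a weight `Δ'`, constants `c` and the Weyl-twisted convergence of the device correlators
  obtain ⟨β, Δ', c, -, -, hconv⟩ :=
    hW P (fun N β n x => annealedDeviceCorr (P N) β n x) hP (fun _ _ _ _ => rfl) ρ S hρ hlim hnd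
  -- E: exact inversion symmetry of the device correlators at every `N`
  have hsym := hE P (fun N β n x => annealedDeviceCorr (P N) β n x) hP (fun _ _ _ _ => rfl)
  -- IT: the symmetry passes to the limit as inversion covariance with weight `Δ'`
  have hinv : IsInversionCovariant Δ' S :=
    hIT Δ' S (fun N => annealedDeviceCorr (P N) β) c hnorm (fun N n x hx => hsym N β n x hx)
      (fun n x hx => (hconv n).tendsto_at hx)
  -- MFI: Möbius covariance with `Δ'`; its scale part and `hsc` pin `Δ' = Δ`
  have hM : IsMoebiusCovariant Δ' S := hMFI Δ' S heuc.1 hinv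
  have hΔ : Δ' = Δ := delta_eq_of_isScaleCovariant hnd hM.isScaleCovariant hsc
  rw [← hΔ]
  exact hinv

/-- **What `W` buys WITHOUT the rotation hypothesis**: every normalised, non-degenerate, translation-invariant
pointwise limit of `criticalCorr 3` is Möbius covariant with some `Δ > 0` — the route header's thesis, as a theorem
modulo `W, E, IT, MFI`. (Rotation invariance of such limits is anyway a theorem of the tree, items 1979/1980.)
[folklore] -/
theorem moebius_of_deviceWeylUniversality
    (hW : ConformalPoissonDevice.DeviceWeylUniversality)
    (hE : ConformalPoissonDevice.DeviceInversionSymmetry)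
    (hIT : ConformalPoissonDevice.InversionTransfer)
    (hMFI : ConformalPoissonDevice.MoebiusFromInversion) :
    ∀ (ρ : ℝ → ℝ) (S : CorrFamily 3), (∀ δ ∈ Set.Ioc (0:ℝ) 1, 0 < ρ δ) →
      HasPointwiseScalingLimit (criticalCorr 3) ρ S → (∀ n z, z ∉ NonCoincident 3 n → S n z = 0) →
      IsNondegenerateTwoPoint S → IsTranslationInvariant S → ∃ Δ : ℝ, 0 < Δ ∧ IsMoebiusCovariant Δ S := by
  intro ρ S hρ hlim hnorm hnd htr
  obtain ⟨P, hP⟩ := exists_deviceLaws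
  obtain ⟨β, Δ', c, -, hΔ', hconv⟩ :=
    hW P (fun N β n x => annealedDeviceCorr (P N) β n x) hP (fun _ _ _ _ => rfl) ρ S hρ hlim hnd
  have hsym := hE P (fun N β n x => annealedDeviceCorr (P N) β n x) hP (fun _ _ _ _ => rfl)
  have hinv : IsInversionCovariant Δ' S :=
    hIT Δ' S (fun N => annealedDeviceCorr (P N) β) c hnorm (fun N n x hx => hsym N β n x hx)
      (fun n x hx => (hconv n).tendsto_at hx)
  exact ⟨Δ', hΔ', hMFI Δ' S htr hinv⟩

/-- **The route's cone is the three hubs.** `W, E, IT, MFI` and the two shared hub items `L` (stmt-1981) and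
`N` (stmt-0636) give the sub-problem — through `summit_iff_three_hubs : S ↔ L ∧ D ∧ N`, i.e. `W`'s whole
contribution to `S` is hub `D`. [folklore] -/
theorem summit_of_route_cone
    (hW : ConformalPoissonDevice.DeviceWeylUniversality)
    (hE : ConformalPoissonDevice.DeviceInversionSymmetry)
    (hIT : ConformalPoissonDevice.InversionTransfer)
    (hMFI : ConformalPoissonDevice.MoebiusFromInversion)
    (hL : ConformalPoissonDevice.ExistsScaleCovariantLimit)
    (hN : ConformalPoissonDevice.IsingEuclidUpgradeR4NonGaussian) :
    _root_.Ising3DConformalLimit :=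
  LimitsAreConformalSummit.summit_iff_three_hubs.2
    ⟨hL, inversionUpgradeNormalised_of_deviceWeylUniversality hW hE hIT hMFI, hN⟩

/-- A sorry-free proof of the route's `Assembly` item (stmt-CriticalPhenomena-4727) through the hub calculus.
[folklore] -/
theorem assembly_via_hubs : ConformalPoissonDevice.Assembly :=
  fun hW hE hIT hMFI hL hN => summit_of_route_cone hW hE hIT hMFI hL hN

/-! ## §4 One level down: the split piece `W''` contains hub `D` for the Poisson–Delaunay model -/

/-- `W''` = the registered stub `stub_deviceWeylLawEven` of the crux (signature verbatim; ledger
`stmt-CriticalPhenomena-4722`, skeleton sha 6e8100c2…): the Weyl law of the device under the conformal change of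
density `N ↦ N(1+‖z‖²)⁻³`, even `n ≥ 2`, polynomially bounded constants. [folklore] -/
def WeylLawEven : Prop :=
  ∀ (P : ℕ → MeasureTheory.Measure (Literature.Analysis.FunctionSpaces.PointConfig (EuclideanSpace ℝ (Fin 3)))), (∀ N : ℕ, Literature.Analysis.FunctionSpaces.IsPoissonPointProcess ((N : ENNReal) • (MeasureTheory.volume : MeasureTheory.Measure (EuclideanSpace ℝ (Fin 3))).withDensity (fun z => ENNReal.ofReal ((1 + ‖z‖ ^ 2) ^ (-(3:ℝ))))) (P N)) → ∀ (β Δ : ℝ) (c : ℕ → ℝ) (T : Literature.Probability.LatticeModels.CorrFamily 3), 0 < β → 0 < Δ → (∀ (n : ℕ) (z : Fin n → EuclideanSpace ℝ (Fin 3)), z ∉ Literature.Probability.LatticeModels.NonCoincident 3 n → T n z = 0) → Literature.Probability.LatticeModels.IsNondegenerateTwoPoint T → Literature.Probability.LatticeModels.IsTranslationInvariant T → Literature.Probability.LatticeModels.IsScaleCovariant Δ T → (∀ n : ℕ, Even n → n ≠ 0 → TendstoLocallyUniformlyOn (fun (N : ℕ) (x : Fin n → EuclideanSpace ℝ (Fin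 3)) => c N ^ n * Literature.Probability.LatticeModels.pdCorr ((N : ENNReal) • (MeasureTheory.volume : MeasureTheory.Measure (EuclideanSpace ℝ (Fin 3)))) β n x) (T n) Filter.atTop (Literature.Probability.LatticeModels.NonCoincident 3 n)) → ∃ c' : ℕ → ℝ, (∃ K : ℕ, ∀ N : ℕ, |c' N| ≤ ((N : ℝ) + 1) ^ K) ∧ ∀ n : ℕ, Even n → n ≠ 0 → TendstoLocallyUniformlyOn (fun (N : ℕ) (x : Fin n → EuclideanSpace ℝ (Fin 3)) => c' N ^ n * Literature.Probability.LatticeModels.annealedDeviceCorr (P N) β n x) (fun x => (∏ i, (1 + ‖x i‖ ^ 2) ^ Δ) * T n x) Filter.atTop (Literature.Probability.LatticeModels.NonCoincident 3 n)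

/-- `U''` = the registered stub `stub_flatUniversalityEven` of the crux (signature verbatim): `ℤ³` ↔ homogeneous
Poisson–Delaunay Ising universality, even `n ≥ 2`. [folklore] -/
def FlatUniversalityEven : Prop :=
  ∀ (ρ : ℝ → ℝ) (S : Literature.Probability.LatticeModels.CorrFamily 3), (∀ δ ∈ Set.Ioc (0:ℝ) 1, 0 < ρ δ) → Literature.Probability.LatticeModels.HasPointwiseScalingLimit (Literature.Probability.LatticeModels.criticalCorr 3) ρ S → Literature.Probability.LatticeModels.IsNondegenerateTwoPoint S → ∃ (β : ℝ) (c : ℕ → ℝ), 0 < β ∧ ∀ n : ℕ, Even n → n ≠ 0 → TendstoLocallyUniformlyOn (fun (N : ℕ) (x : Fin n → EuclideanSpace ℝ (Fin 3)) => c N ^ n * Literature.Probability.LatticeModels.pdCorr ((N : ENNReal) • (MeasureTheory.volume : MeasureTheory.Measure (EuclideanSpace ℝ (Fin 3)))) β n x) (S n) Filter.atTop (Literature.Probability.LatticeModels.NonCoincident 3 n)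

/-- Sanity: the landed split (p156513) in this file's spelling — `U'' → W'' → W`. [folklore] -/
theorem crux_of_split (hU : FlatUniversalityEven) (hW : WeylLawEven) :
    ConformalPoissonDevice.DeviceWeylUniversality :=
  DeviceWeylUniversality.deviceWeylUniversality_of_flatUniversality_of_weylLaw hU hW

/-- **`W''` forces `D_PD` (indeed Möbius covariance) on every admissible flat Poisson–Delaunay limit.** If `T` is a
normalised, non-degenerate, translation-invariant, `Δ`-scale-covariant family with `T₀ = 1` and vanishing odd
correlations (as every Ising-class limit), and the homogeneous Poisson–Delaunay Ising correlators at `β` converge to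
`T` on even `n ≥ 2`, then `W''` (with the route glue `E, IT, MFI`) makes `T` Möbius covariant: the device limit
exists by `W''`, is exactly `ι`-symmetric by `E` (odd `n` and `n = 0` by the landed `stub_deviceOdd`,
`stub_deviceZero`), and `IT` + `MFI` upgrade.  So proving `W''` proves the scale ⇒ conformal upgrade (hub `D`) for
the Poisson–Delaunay model. [folklore] -/
theorem flatPDLimit_moebius_of_weylLawEven (hW'' : WeylLawEven)
    (hE : ConformalPoissonDevice.DeviceInversionSymmetry)
    (hIT : ConformalPoissonDevice.InversionTransfer)
    (hMFI : ConformalPoissonDevice.MoebiusFromInversion) :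
    ∀ (β Δ : ℝ) (c : ℕ → ℝ) (T : CorrFamily 3), 0 < β → 0 < Δ →
      (∀ (n : ℕ) (z : Fin n → EuclideanSpace ℝ (Fin 3)), z ∉ NonCoincident 3 n → T n z = 0) →
      IsNondegenerateTwoPoint T → IsTranslationInvariant T → IsScaleCovariant Δ T →
      (∀ x : Fin 0 → EuclideanSpace ℝ (Fin 3), T 0 x = 1) →
      (∀ n : ℕ, Odd n → ∀ x : Fin n → EuclideanSpace ℝ (Fin 3), T n x = 0) →
      (∀ n : ℕ, Even n → n ≠ 0 → TendstoLocallyUniformlyOn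
        (fun (N : ℕ) (x : Fin n → EuclideanSpace ℝ (Fin 3)) => c N ^ n *
          pdCorr ((N : ENNReal) • (volume : Measure (EuclideanSpace ℝ (Fin 3)))) β n x)
        (T n) atTop (NonCoincident 3 n)) →
      IsMoebiusCovariant Δ T := by
  intro β Δ c T hβ hΔ hnorm hnd htr hsc h0 hodd hflat
  obtain ⟨P, hP⟩ := exists_deviceLaws
  have hW := hW''
  unfold WeylLawEven at hW
  obtain ⟨c', ⟨K, hK⟩, hdev⟩ := hW P hP β Δ c T hβ hΔ hnorm hnd htr hsc hflat
  have hsym := hE P (fun N β n x => annealedDeviceCorr (P N) β n x) hP (fun _ _ _ _ => rfl)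
  have hconv : ∀ n : ℕ, ∀ x ∈ NonCoincident 3 n,
      Tendsto (fun N : ℕ => c' N ^ n * annealedDeviceCorr (P N) β n x) atTop
        (𝓝 ((∏ i, (1 + ‖x i‖ ^ 2) ^ Δ) * T n x)) := by
    intro n x hx
    rcases Nat.even_or_odd n with hn | hn
    · rcases eq_or_ne n 0 with rfl | hn0
      · have h1 : ∀ N : ℕ, c' N ^ 0 * annealedDeviceCorr (P N) β 0 x =
            (∏ i, (1 + ‖x i‖ ^ 2) ^ Δ) * T 0 x := by
          intro N
          rw [pow_zero, one_mul, DeviceWeylUniversality.stub_deviceZero P hP β N x, h0 x,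
            Fin.prod_univ_zero, one_mul]
        exact tendsto_const_nhds.congr fun N => (h1 N).symm
      · exact (hdev n hn hn0).tendsto_at hx
    · have h := (DeviceWeylUniversality.stub_deviceOdd P hP β c' K hK n hn).tendsto_at hx
      rw [hodd n hn x, mul_zero]
      exact h
  have hinv : IsInversionCovariant Δ T :=
    hIT Δ T (fun N => annealedDeviceCorr (P N) β) c' hnorm (fun N n x hx => hsym N β n x hx) hconv
  exact hMFI Δ T htr hinv

/-! ## §5 The census's `## Strengthen` candidate S⁺, typed: general density invariance (BS98-style) -/

/-- **S⁺ = `DensityInvarianceEven`** (the Ising face of Benjamini–Schramm's general Density Invariance Conjecture,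
CMP 197 (1998) §10, which its authors expect "probably true only in dimension d = 2"): for EVERY continuous density
`f` with two-sided bounds, the homogeneous-limit `T` is transported to intensity `N·f(z)dz` with the Weyl factor
`∏ᵢ f(xᵢ)^{-Δ/3}` (even `n ≥ 2`). `W''` is its instance at the one conformal density `f = (1+‖z‖²)⁻³` (up to the
finite-configuration packaging of the device). In `d = 3` a non-constant `f` other than `|φ′|³`, `φ` Möbius, is induced by
no conformal map (`Literature.Barriers.CriticalPhenomena.LiouvilleRigidity`), so S⁺ asserts covariance under local
rescalings that are not symmetries of any candidate limit: the rigid strengthening is expected FALSE and gives no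
inductive handle on `W''` (census `## Strengthen`). Stated only; used by nothing. [folklore] -/
def DensityInvarianceEven : Prop :=
  ∀ (f : EuclideanSpace ℝ (Fin 3) → ℝ), Continuous f → (∃ a b : ℝ, 0 < a ∧ ∀ z, a ≤ f z ∧ f z ≤ b) →
    ∀ (β Δ : ℝ) (c : ℕ → ℝ) (T : CorrFamily 3), 0 < β → 0 < Δ →
      (∀ (n : ℕ) (z : Fin n → EuclideanSpace ℝ (Fin 3)), z ∉ NonCoincident 3 n → T n z = 0) →
      IsNondegenerateTwoPoint T → IsTranslationInvariant T → IsScaleCovariant Δ T →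
      (∀ n : ℕ, Even n → n ≠ 0 → TendstoLocallyUniformlyOn
        (fun (N : ℕ) (x : Fin n → EuclideanSpace ℝ (Fin 3)) => c N ^ n *
          pdCorr ((N : ENNReal) • (volume : Measure (EuclideanSpace ℝ (Fin 3)))) β n x)
        (T n) atTop (NonCoincident 3 n)) →
      ∃ c' : ℕ → ℝ, ∀ n : ℕ, Even n → n ≠ 0 → TendstoLocallyUniformlyOn
        (fun (N : ℕ) (x : Fin n → EuclideanSpace ℝ (Fin 3)) => c' N ^ n *
          pdCorr ((N : ENNReal) • (volume : Measure (EuclideanSpace ℝ (Fin 3))).withDensity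
            (fun z => ENNReal.ofReal (f z))) β n x)
        (fun x => (∏ i, f (x i) ^ (-(Δ / 3))) * T n x) atTop (NonCoincident 3 n)

end Summit.CriticalPhenomena.Ising3DConformalLimit.Cruxes.DeviceWeylUniversality.Costume

end
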